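import Summits.BirchSwinnertonDyer.BirchSwinnertonDyer.Theorems.PrintCf2SplitBadTwoCMScalarAtVOfEtale
import Summits.BirchSwinnertonDyer.BirchSwinnertonDyer.Theorems.PrintCf2SplitBadTwoH1TwoTorsionOfConj
import HarnessLib

/-!
# (ET-v) from two local inputs at `v`: the cohomological plumbing of `hET_holds`

Crux `stmt-BirchSwinnertonDyer-20368` (`PrintCf2.SplitBadTwoRankOneOfFacts`), road α, LEAD ruling (R-ET) 2026-08-29: the hfin-free
brick (ET-v) «`2 • res_{D_v}(e_* κ_n(Q)) = 0`» (hypothesis `hET` of -w3 g10 `CMPrimes.cmScalar_localPoints_of_frame_of_etale`,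
p682736). This file is the COHOMOLOGICAL PLUMBING: it unpacks the class `res_{D_v}(e_* res_⊤ κ_n(Q))` into the explicit cocycle
`σ ↦ e(σR − R)` (`2ⁿR = Q`) on `D_v = ⊤ ⊓ decomp v` and applies the generic lemma of `PrintCf2SplitBadTwoH1TwoTorsionOfConj`
(`2·[f] = 0` as soon as an element `c ∈ D_v` acts as `−1` on the coefficients `W*` and `f(σcσ⁻¹) = f(c)`), reducing (ET-v) —
in the EXACT displayed form of `hET` — to two LOCAL ARITHMETIC inputs at `v`:
* (L1) an element `c ∈ D_v` acting as `−1` on `W* = E[𝔮_r^∞]` (an inertia element negating `√d`, -w2 g8's named unramified type);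
* (L2) for every `σ ∈ D_v`, the `W*`-component of the Kummer cocycle vanishes at the commutator `j = c⁻¹σcσ⁻¹`
  (`e(jR − R) = 0`; `j` lies in the inertia of `K_v(√d)`, where Greenberg's reduction argument for the good twist `cm7`
  puts `jR − R` in the kernel-of-reduction line `W*′ = ker e`, LNM 1716 §2 Prop. 2.2).
Main: `two_nsmul_resOfLe_kummer_eq_zero_of_localInputs`. No definition, no named fact, no `sorry`. BSD is not proved by any of this.

References: [GreenbergLNM1716] §2 Props. 2.1–2.4; [SerreGaloisCohomology1997] I.§2.2, I.§5.1; [Rubin1999] §3 Lemma 3.6 (ii).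
-/

noncomputable section

open scoped Classical

set_option linter.dupNamespace false
set_option autoImplicit false

open NumberField IsDedekindDomain Field WeierstrassCurve
open Literature.NumberTheory.EllipticCurves Literature.NumberTheory.EllipticCurves.GreenbergSelmer
open Literature.NumberTheory.EllipticCurves.ResKernel
open Literature.NumberTheory.GaloisRepresentations

namespace Summit.BirchSwinnertonDyer.BirchSwinnertonDyer.Theorems.PrintCf2.CMPrimes

variable {K : Type} [Field K] [NumberField K]

/-- **(ET-v) from the two local inputs (L1), (L2).** For `V/K` elliptic, `π ∈ End_K(V)`, a `2`-adic parameter `r`, the CM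
summand `W* = V.endEigenPrimaryTorsion 2 π r` with an equivariant map `e : V[2^∞] → W*`, a place `v`, a point `Q ∈ V(K)` and a
level `n` (`R` = the chosen `2ⁿ`-th root of `Q`): if some `c ∈ D_v = ⊤ ⊓ decomp v` acts as `−1` on `W*` and
`e((c⁻¹σcσ⁻¹)R − R) = 0` for every `σ ∈ D_v`, then `2 • res_{D_v}(e_* res_⊤ κ_n(Q)) = 0`.
[cite: GreenbergLNM1716, §2 Props. 2.1–2.4] [cite: SerreGaloisCohomology1997, I.§5.1] -/
theorem two_nsmul_resOfLe_kummer_eq_zero_of_localInputs (V : WeierstrassCurve K) [V.IsElliptic]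
    (π : V.endRing) (r : ℤ_[2]) (v : HeightOneSpectrum (𝓞 K))
    (e : V.geomPrimaryTorsion 2 →+ ↥(V.endEigenPrimaryTorsion 2 π r))
    (he : ∀ (σ : absoluteGaloisGroup K) (x : V.geomPrimaryTorsion 2), e (σ • x) = σ • e x)
    (c : absoluteGaloisGroup K) (hcD : c ∈ (⊤ ⊓ decomp v : Subgroup (absoluteGaloisGroup K)))
    (hc : ∀ x : ↥(V.endEigenPrimaryTorsion 2 π r), c • x = -x) (Q : V.toAffine.Point) (n : ℕ)
    (hj : ∀ σ ∈ (⊤ ⊓ decomp v : Subgroup (absoluteGaloisGroup K)),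
      haveI : Fact (Nat.Prime 2) := ⟨Nat.prime_two⟩
      e ((V.kummerCocycle 2 n (V.kummerRoot 2 V.zsmul_geomPoints_surjective_holds n Q)
        (smul_nsmul_of_nsmul_eq V 2 (nsmul_kummerRoot V 2 V.zsmul_geomPoints_surjective_holds n Q))).1
          (c⁻¹ * σ * c * σ⁻¹)) = 0) :
    haveI : Fact (Nat.Prime 2) := ⟨Nat.prime_two⟩
    2 • resOfLe ↥(V.endEigenPrimaryTorsion 2 π r) (inf_le_left : ⊤ ⊓ decomp v ≤ ⊤)
      (resH1Hom (ContinuousMonoidHom.id (⊤ : Subgroup (absoluteGaloisGroup K))) e (fun σ x ↦ he σ x)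
        (resSubgroup ⊤ (V.geomPrimaryTorsion 2)
          (V.kummerMapLevel 2 V.zsmul_geomPoints_surjective_holds n Q))) = 0 := by
  haveI : Fact (Nat.Prime 2) := ⟨Nat.prime_two⟩
  set κ := V.kummerCocycle 2 n (V.kummerRoot 2 V.zsmul_geomPoints_surjective_holds n Q)
    (smul_nsmul_of_nsmul_eq V 2 (nsmul_kummerRoot V 2 V.zsmul_geomPoints_surjective_holds n Q)) with hκ
  have hlevel : V.kummerMapLevel 2 V.zsmul_geomPoints_surjective_holds n Q = oneCocycleClass _ κ := rfl
  rw [hlevel, ResKernel.resSubgroup_oneCocycleClass, resH1Hom_oneCocycleClass,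
    show resOfLe ↥(V.endEigenPrimaryTorsion 2 π r) (inf_le_left : ⊤ ⊓ decomp v ≤ ⊤) =
      resH1Hom (subgroupInclusion (inf_le_left : ⊤ ⊓ decomp v ≤ ⊤)) (AddMonoidHom.id _) (fun _ _ ↦ rfl) from rfl,
    resH1Hom_oneCocycleClass]
  -- the explicit cocycle on `D_v`: `τ ↦ e (κ τ)`
  refine two_nsmul_oneCocycleClass_eq_zero_of_conj _ (c := ⟨c, hcD⟩) (fun m ↦ ?_) (fun τ ↦ ?_)
  · rw [Subgroup.smul_def]
    exact hc m
  · -- values of the pulled-back cocycle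
    have hval : ∀ τ : ↥(⊤ ⊓ decomp v : Subgroup (absoluteGaloisGroup K)),
        (contOneCocycles.pullback (subgroupInclusion (inf_le_left : ⊤ ⊓ decomp v ≤ ⊤))
          (resHomOfEquivariant (subgroupInclusion (inf_le_left : ⊤ ⊓ decomp v ≤ ⊤)) (AddMonoidHom.id _) (fun _ _ ↦ rfl))
          (contOneCocycles.pullback (ContinuousMonoidHom.id (⊤ : Subgroup (absoluteGaloisGroup K)))
            (resHomOfEquivariant (ContinuousMonoidHom.id (⊤ : Subgroup (absoluteGaloisGroup K))) e (fun σ x ↦ he σ x))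
            (contOneCocycles.pullback (Literature.NumberTheory.EllipticCurves.subgroupIncl (⊤ : Subgroup (absoluteGaloisGroup K)))
              (resHomOfEquivariant (Literature.NumberTheory.EllipticCurves.subgroupIncl ⊤) (AddMonoidHom.id (V.geomPrimaryTorsion 2))
                (fun _ _ ↦ rfl)) κ))).1 τ =
          e (κ.1 (τ : absoluteGaloisGroup K)) := fun τ ↦ rfl
    rw [hval, hval]
    -- `σ c σ⁻¹ = c · j` with `j = c⁻¹ σ c σ⁻¹`; the cocycle identity and (L1), (L2)
    have hmul : ((τ * ⟨c, hcD⟩ * τ⁻¹ : ↥(⊤ ⊓ decomp v : Subgroup (absoluteGaloisGroup K))) : absoluteGaloisGroup K) =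
        c * (c⁻¹ * (τ : absoluteGaloisGroup K) * c * (τ : absoluteGaloisGroup K)⁻¹) := by
      simp only [Subgroup.coe_mul, Subgroup.coe_inv]; group
    rw [hmul, cocycle_mul' κ c, map_add, he, hc, hj _ τ.2, neg_zero, add_zero]

end Summit.BirchSwinnertonDyer.BirchSwinnertonDyer.Theorems.PrintCf2.CMPrimes

end
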